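import Mathlib
import Literature.NumberTheory.Automorphic.ModularEisensteinSeries

/-!
# The theta series of `ℤz + ℤ` and the meromorphic continuation of `E(z, s)` for `SL₂(ℤ)`
(Iwaniec, *Spectral Methods of Automorphic Forms*, GSM 53, §3.4 (3.26)–(3.31), PDF pp. 46–47)

Seventeenth layer of the `provefact` decomposition of `Literature.NumberTheory.Automorphic.sl2BallCount_asymp`
(`HyperbolicLatticeCount.lean`), eighth brick of the spectral theory of `L²(SL₂(ℤ)\\ℍ)` behind
`Iwaniec2002_thm_7_4_modular` (`ModularPretrace.lean`). The `ModularSpectralDatum` there asks for the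
Eisenstein series on the critical line `Re s = 1/2`, beyond the half-plane of absolute convergence
of `ModularEisensteinSeries.lean`. Iwaniec (p. 47) obtains the meromorphic continuation of `E(z, s)`
and the functional equation (3.31) `θ(s)E(z, s) = θ(1 - s)E(z, 1 - s)`, `θ(s) = π^{-s}Γ(s)ζ(2s)`
((3.27)), from the Fourier expansion (3.29) (`K`-Bessel functions, divisor sums). Here the *same
statements* are proved by Riemann's method instead — the route Mathlib supports end-to-end
(`WeakFEPair`, `jacobiTheta`/`Complex.tsum_exp_neg_quadratic`, `hasSum_mellin_pi_mul₀`):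
`θ(s)E(z, s)` is half the completed Epstein zeta function of the binary quadratic form
`Q_z(c, d) = |cz + d|²/y`, i.e. the Mellin transform of the theta series of the lattice `ℤz + ℤ`.
Everything here is proved; nothing is vendored.

1. `qForm z v = |cz + d|²/y` and `thetaQ z t = Θ_z(t) = Σ_{(c,d) ∈ ℤ²} e^{-π t Q_z(c,d)}`:
   summability, the tail bound `Θ_z(t) - 1 ≤ e^{-π(t-1) r(z)²/y}(Θ_z(1) - 1)`, joint continuity
   in `(z, t)`.
2. **`Θ_z(1/t) = t Θ_z(t)`** (`thetaQ_functional_equation`) — Poisson summation in one variable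
   (`tsum_exp_neg_sq_shift`) applied in `d` and the `(c, d) ↔ (d, c)` symmetry of the resulting dual
   series (`dTerm`, `thetaQ_eq_sqrt_mul_tsum`).
3. `thetaFEPair z : WeakFEPair ℂ` (`k = 1`, `ε = 1`, `f₀ = g₀ = 1`) and
   **`completedEisenstein z s = E*(z, s) := Λ_z(s)/2`**, defined for all `s`: entire part
   `completedEisenstein₀`, poles at `s = 0, 1` only (`completedEisenstein_eq`), holomorphy elsewhere,
   and the **functional equation `E*(z, 1 - s) = E*(z, s)`** ((3.31), `completedEisenstein_one_sub`).
4. **`E*(z, s) = π^{-s} Γ(s) ζ(2s) E(z, s)` for `Re s > 1`** (`completedEisenstein_eq_theta_mul`,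
   (3.27)): the Mellin transform of `Θ_z - 1` termwise, and
   `Σ_{ℤ² ∖ 0} Q_z^{-s} = ζ(2s) Σ_{(c,d)=1} Q_z^{-s}` by sorting by the gcd
   (`tsum_esTerm_eq_zeta_mul`, after `EisensteinSeries.gammaSetDivGcdSigmaEquiv`).
5. **Automorphy for all `s`**: `Q_{Az}(v) = Q_z(vA)`, `Θ_{Az} = Θ_z`, `E*(Az, s) = E*(z, s)` for
   `A ∈ SL₂(ℤ)` (`completedEisenstein_smul`).

What is *not* here: that `E*(·, s)` is a `C²` eigenfunction of `Δ` beyond `Re s > 1` (next layer, by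
analytic continuation of `L_k E* = h_k E*`), and the Fourier expansion itself.

## References
* [Iwaniec2002] H. Iwaniec, *Spectral Methods of Automorphic Forms*, 2nd ed., GSM 53, AMS 2002,
  §3.4, (3.26)–(3.31), PDF pp. 46–47; §3.1 (3.1), PDF p. 40.
-/

noncomputable section

namespace Literature.NumberTheory.Automorphic

open MeasureTheory Set Filter Real UpperHalfPlane EisensteinSeries
open scoped Topology MatrixGroups ModularForm ENNReal

/-! ## The theta series of the lattice `ℤz + ℤ` and Riemann's continuation of `E(z, s)` -/

section Theta

/-! ### The binary quadratic form `Q_z(c, d) = |cz + d|² / y` -/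

/-- `Q_z(c, d) = |cz + d|²/Im z`, the positive definite binary quadratic form (of discriminant `-4`)
attached to `z ∈ ℍ`; `(Im γz)^s = Q_z(c, d)^{-s}` for `γ = (* *; c d)`. [folklore] -/
noncomputable def qForm (z : ℍ) (v : Fin 2 → ℤ) : ℝ := ‖(v 0 : ℂ) * z + v 1‖ ^ 2 / z.im

/-- `Q_z ≥ 0`. [folklore] -/
theorem qForm_nonneg (z : ℍ) (v : Fin 2 → ℤ) : 0 ≤ qForm z v := by unfold qForm; positivity

/-- `Q_z(0) = 0`. [folklore] -/
@[simp] theorem qForm_zero (z : ℍ) : qForm z 0 = 0 := by simp [qForm]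

/-- `cz + d ≠ 0` for `(c, d) ≠ 0`. [folklore] -/
theorem linear_ne_zero_of_ne_zero {v : Fin 2 → ℤ} (hv : v ≠ 0) (z : ℍ) : (v 0 : ℂ) * z + v 1 ≠ 0 := by
  have hne : (fun i => (v i : ℝ)) ≠ 0 := by
    intro h; apply hv; ext i
    have := congrFun h i
    simpa using this
  simpa using UpperHalfPlane.linear_ne_zero z hne

/-- `Q_z(v) > 0` for `v ≠ 0`. [folklore] -/
theorem qForm_pos (z : ℍ) {v : Fin 2 → ℤ} (hv : v ≠ 0) : 0 < qForm z v :=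
  div_pos (pow_pos (norm_pos_iff.mpr (linear_ne_zero_of_ne_zero hv z)) 2) z.im_pos

/-- `Q_z(v) = 0 ↔ v = 0`. [folklore] -/
theorem qForm_eq_zero_iff (z : ℍ) (v : Fin 2 → ℤ) : qForm z v = 0 ↔ v = 0 := by
  refine ⟨fun h => ?_, fun h => by rw [h, qForm_zero]⟩
  by_contra hv
  exact (qForm_pos z hv).ne' h

/-- In coordinates: `Q_z(c, d) = ((cx + d)² + c²y²)/y`. [folklore] -/
theorem qForm_apply (z : ℍ) (v : Fin 2 → ℤ) :
    qForm z v = ((v 0 * z.re + v 1) ^ 2 + (v 0) ^ 2 * z.im ^ 2) / z.im := by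
  unfold qForm
  congr 1
  rw [Complex.sq_norm, Complex.normSq_apply]
  simp only [Complex.add_re, Complex.mul_re, Complex.intCast_re, Complex.intCast_im, zero_mul,
    sub_zero, Complex.add_im, Complex.mul_im, add_zero, UpperHalfPlane.coe_re, UpperHalfPlane.coe_im]
  ring

/-- **Lattice lower bound** `Q_z(v) ≥ r(z)² ‖v‖² / y` (`EisensteinSeries.r_mul_max_le`). [folklore] -/
theorem qForm_ge (z : ℍ) (v : Fin 2 → ℤ) : r z ^ 2 * ‖v‖ ^ 2 / z.im ≤ qForm z v := by
  by_cases hv : v = 0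
  · subst hv; simp
  unfold qForm
  have h := r_mul_max_le z hv
  have h0 : 0 ≤ r z * ‖v‖ := mul_nonneg (r_pos z).le (norm_nonneg _)
  rw [← mul_pow]
  gcongr

/-- `‖v‖ ≥ 1` for a non-zero integer vector. [folklore] -/
theorem one_le_norm_of_ne_zero {v : Fin 2 → ℤ} (hv : v ≠ 0) : 1 ≤ ‖v‖ := by
  rw [norm_eq_max_natAbs]
  have : v 0 ≠ 0 ∨ v 1 ≠ 0 := by
    by_contra h
    simp only [not_or, not_not] at h
    exact hv (by ext i; fin_cases i <;> simp [h.1, h.2])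
  have h' : 1 ≤ max (v 0).natAbs (v 1).natAbs := by
    rcases this with h | h
    · exact le_max_of_le_left (Int.natAbs_pos.mpr h)
    · exact le_max_of_le_right (Int.natAbs_pos.mpr h)
  exact_mod_cast h'

/-- `e^{-w} ≤ 2/w²` for `w > 0`. [folklore] -/
theorem exp_neg_le_two_div_sq {w : ℝ} (hw : 0 < w) : Real.exp (-w) ≤ 2 / w ^ 2 := by
  have h := Real.pow_div_factorial_le_exp (x := w) hw.le 2
  norm_num [Nat.factorial] at h
  rw [Real.exp_neg, inv_eq_one_div, div_le_div_iff₀ (Real.exp_pos _) (by positivity)]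
  linarith

/-- `Σ_v e^{-a‖v‖²} < ∞` over `ℤ²`, `a > 0`. [folklore] -/
theorem summable_exp_neg_mul_norm_sq {a : ℝ} (ha : 0 < a) :
    Summable fun v : Fin 2 → ℤ => Real.exp (-a * ‖v‖ ^ 2) := by
  refine Summable.of_norm_bounded_eventually
    ((summable_one_div_norm_rpow (k := 4) (by norm_num)).mul_left (2 / a ^ 2)) ?_
  filter_upwards [eventually_cofinite_ne (0 : Fin 2 → ℤ)] with v hv
  have h1 := one_le_norm_of_ne_zero hv
  have hw : 0 < a * ‖v‖ ^ 2 := by positivity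
  rw [Real.norm_eq_abs, abs_of_pos (Real.exp_pos _), show -a * ‖v‖ ^ 2 = -(a * ‖v‖ ^ 2) by ring]
  refine (exp_neg_le_two_div_sq hw).trans (le_of_eq ?_)
  rw [Real.rpow_neg (norm_nonneg _), show (4 : ℝ) = ((4 : ℕ) : ℝ) by norm_num, Real.rpow_natCast]
  field_simp

/-- The theta summand is dominated by `e^{-π t r(z)²‖v‖²/y}`. [folklore] -/
theorem exp_qForm_le (z : ℍ) {t : ℝ} (ht : 0 ≤ t) (v : Fin 2 → ℤ) :
    Real.exp (-π * t * qForm z v) ≤ Real.exp (-(π * t * r z ^ 2 / z.im) * ‖v‖ ^ 2) := by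
  refine Real.exp_le_exp.mpr ?_
  have h := qForm_ge z v
  have : π * t * (r z ^ 2 * ‖v‖ ^ 2 / z.im) ≤ π * t * qForm z v := by gcongr
  have e : -(π * t * r z ^ 2 / z.im) * ‖v‖ ^ 2 = -(π * t * (r z ^ 2 * ‖v‖ ^ 2 / z.im)) := by ring
  rw [e]; linarith

/-- **Summability of the theta series** for `t > 0`. [folklore] -/
theorem summable_exp_qForm (z : ℍ) {t : ℝ} (ht : 0 < t) :
    Summable fun v : Fin 2 → ℤ => Real.exp (-π * t * qForm z v) := by
  refine Summable.of_nonneg_of_le (fun v => (Real.exp_pos _).le) (exp_qForm_le z ht.le)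
    (summable_exp_neg_mul_norm_sq ?_)
  have := r_pos z
  have := z.im_pos
  positivity

/-! ### The theta series `Θ_z(t) = Σ_{(c,d) ∈ ℤ²} e^{-π t Q_z(c, d)}` -/

/-- **The theta series of the lattice `ℤz + ℤ`**: `Θ_z(t) = Σ_{(c, d) ∈ ℤ²} exp(-π t |cz + d|²/y)`,
`t > 0`. [folklore] -/
noncomputable def thetaQ (z : ℍ) (t : ℝ) : ℝ := ∑' v : Fin 2 → ℤ, Real.exp (-π * t * qForm z v)

/-- The complex form of `Θ_z(t)`. [folklore] -/
theorem thetaQ_coe (z : ℍ) (t : ℝ) :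
    (thetaQ z t : ℂ) = ∑' v : Fin 2 → ℤ, Complex.exp (-π * t * qForm z v : ℝ) := by
  unfold thetaQ
  rw [Complex.ofReal_tsum]
  simp [Complex.ofReal_exp]

/-- `Θ_z(t) - 1 = Σ_{v ≠ 0} e^{-π t Q_z(v)}` as a `HasSum` in the form used by
`hasSum_mellin_pi_mul₀`. [folklore] -/
theorem hasSum_thetaQ_sub_one (z : ℍ) {t : ℝ} (ht : 0 < t) :
    HasSum (fun v : Fin 2 → ℤ => if qForm z v = 0 then (0 : ℂ) else 1 * (Real.exp (-π * qForm z v * t) : ℝ))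
      ((thetaQ z t : ℂ) - 1) := by
  have hs : HasSum (fun v : Fin 2 → ℤ => (Complex.exp (-π * t * qForm z v : ℝ))) (thetaQ z t : ℂ) := by
    rw [thetaQ_coe]
    have h := summable_exp_qForm z ht
    have h' : Summable fun v : Fin 2 → ℤ => Complex.exp (-π * t * qForm z v : ℝ) := by
      have := (Complex.ofRealCLM.summable h)
      simpa [Complex.ofReal_exp] using this
    exact h'.hasSum
  have h2 := hasSum_ite_sub_hasSum hs 0
  simp only [qForm_zero, mul_zero, Complex.ofReal_zero, Complex.exp_zero] at h2
  have e : (fun v : Fin 2 → ℤ => if qForm z v = 0 then (0 : ℂ) else 1 * (Real.exp (-π * qForm z v * t) : ℝ)) =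
      fun v => if v = 0 then 0 else Complex.exp (-π * t * qForm z v : ℝ) := by
    funext v
    by_cases hv : v = 0
    · subst hv; simp
    · rw [if_neg ((qForm_eq_zero_iff z v).not.mpr hv), if_neg hv, one_mul, Complex.ofReal_exp]
      push_cast; ring_nf
  rw [e]; exact h2

/-- `Θ_z(t) ≥ 1` and the tail is non-negative: `0 ≤ Θ_z(t) - 1`. [folklore] -/
theorem one_le_thetaQ (z : ℍ) {t : ℝ} (ht : 0 < t) : 1 ≤ thetaQ z t := by
  unfold thetaQ
  rw [(summable_exp_qForm z ht).tsum_eq_add_tsum_ite 0]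
  simp only [qForm_zero, mul_zero, Real.exp_zero, le_add_iff_nonneg_right]
  exact tsum_nonneg fun v => by split_ifs <;> [exact le_rfl; exact (Real.exp_pos _).le]

/-- **Exponential decay of the tail**: `Θ_z(t) - 1 ≤ e^{-π (t-1) r(z)²/y} (Θ_z(1) - 1)` for `t ≥ 1`. [folklore] -/
theorem thetaQ_sub_one_le (z : ℍ) {t : ℝ} (ht : 1 ≤ t) :
    thetaQ z t - 1 ≤ Real.exp (-(π * (t - 1) * r z ^ 2 / z.im)) * (thetaQ z 1 - 1) := by
  have h1 := summable_exp_qForm z (one_pos.trans_le ht)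
  have h0 := summable_exp_qForm z one_pos
  unfold thetaQ
  rw [h1.tsum_eq_add_tsum_ite 0, h0.tsum_eq_add_tsum_ite 0]
  simp only [qForm_zero, mul_zero, Real.exp_zero, add_sub_cancel_left]
  rw [← tsum_mul_left]
  refine Summable.tsum_le_tsum (fun v => ?_) ?_ ?_
  · split_ifs with hv
    · simp
    · have hq : r z ^ 2 / z.im ≤ qForm z v := by
        have h := qForm_ge z v
        have h1 := one_le_norm_of_ne_zero hv
        have hv2 : (1 : ℝ) ≤ ‖v‖ ^ 2 := one_le_pow₀ h1
        have : r z ^ 2 / z.im ≤ r z ^ 2 * ‖v‖ ^ 2 / z.im := by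
          have := z.im_pos
          rw [div_le_div_iff_of_pos_right this]
          nlinarith [sq_nonneg (r z)]
        exact this.trans h
      rw [← Real.exp_add]
      refine Real.exp_le_exp.mpr ?_
      have : π * (t - 1) * (r z ^ 2 / z.im) ≤ π * (t - 1) * qForm z v := by
        have : 0 ≤ π * (t - 1) := by have := Real.pi_pos; nlinarith
        exact mul_le_mul_of_nonneg_left hq this
      have e : -(π * (t - 1) * r z ^ 2 / z.im) = -(π * (t - 1) * (r z ^ 2 / z.im)) := by ring
      rw [e]; nlinarith
  · refine Summable.of_nonneg_of_le (fun v => ?_) (fun v => ?_) h1 <;> split_ifs <;> simp [(Real.exp_pos _).le]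
  · exact (Summable.of_nonneg_of_le (fun v => by split_ifs <;> simp [(Real.exp_pos _).le])
      (fun v => by split_ifs <;> simp [(Real.exp_pos _).le]) h0).mul_left _

/-- `Θ_z(t) - 1 = O(t^b)` for every `b` as `t → ∞`. [folklore] -/
theorem isBigO_thetaQ_sub_one (z : ℍ) (b : ℝ) :
    (fun t : ℝ => (thetaQ z t : ℂ) - 1) =O[atTop] (· ^ b) := by
  have ha : 0 < π * r z ^ 2 / z.im := by have := r_pos z; have := z.im_pos; positivity
  have h1 : (fun t : ℝ => (thetaQ z t : ℂ) - 1) =O[atTop] fun t => Real.exp (-(π * r z ^ 2 / z.im) * t) := by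
    refine Asymptotics.IsBigO.of_bound (Real.exp (π * r z ^ 2 / z.im) * (thetaQ z 1 - 1)) ?_
    filter_upwards [eventually_ge_atTop (1 : ℝ)] with t ht
    rw [← Complex.ofReal_one, ← Complex.ofReal_sub, Complex.norm_real, Real.norm_eq_abs,
      abs_of_nonneg (by linarith [one_le_thetaQ z (one_pos.trans_le ht)]), Real.norm_eq_abs,
      abs_of_pos (Real.exp_pos _)]
    refine (thetaQ_sub_one_le z ht).trans (le_of_eq ?_)
    have e : -(π * (t - 1) * r z ^ 2 / z.im) = π * r z ^ 2 / z.im + -(π * r z ^ 2 / z.im) * t := by ring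
    rw [e, Real.exp_add]; ring
  exact h1.trans (isLittleO_exp_neg_mul_rpow_atTop ha b).isBigO


/-! ### Poisson summation in one variable and the functional equation `Θ_z(1/t) = t Θ_z(t)` -/

/-- Gaussian summability over `ℤ`. [folklore] -/
theorem summable_exp_neg_mul_int_sq {a : ℝ} (ha : 0 < a) : Summable fun n : ℤ => Real.exp (-a * (n : ℝ) ^ 2) := by
  have hinj : Function.Injective (fun n : ℤ => (![0, n] : Fin 2 → ℤ)) := fun m n h => by
    simpa using congrFun h 1
  refine ((summable_exp_neg_mul_norm_sq ha).comp_injective hinj).congr fun n => ?_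
  simp only [Function.comp_def, norm_eq_max_natAbs, Matrix.cons_val_zero, Matrix.cons_val_one,
    Int.natAbs_zero]
  rw [Nat.cast_max, Nat.cast_zero, max_eq_right (Nat.cast_nonneg _), Nat.cast_natAbs]
  simp only [Int.cast_abs, sq_abs]

/-- **Poisson summation for a shifted Gaussian**: `Σ_n e^{-(π/a)(n + α)²} = √a Σ_n e^{-π a n² - 2π i α n}`
(`Complex.tsum_exp_neg_quadratic`). [folklore] -/
theorem tsum_exp_neg_sq_shift {a : ℝ} (ha : 0 < a) (α : ℝ) :
    ∑' n : ℤ, Complex.exp (-(π / a * (n + α) ^ 2) : ℝ) =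
      (Real.sqrt a : ℂ) * ∑' n : ℤ, Complex.exp (-π * a * (n : ℂ) ^ 2 - 2 * π * Complex.I * α * n) := by
  have ha' : 0 < ((a : ℝ) : ℂ).re := by simp [ha]
  have h := Complex.tsum_exp_neg_quadratic ha' (-Complex.I * α)
  have hsq : ((a : ℝ) : ℂ) ^ (1 / 2 : ℂ) = (Real.sqrt a : ℂ) := by
    rw [Real.sqrt_eq_rpow, Complex.ofReal_cpow ha.le]; norm_num
  have hne : (Real.sqrt a : ℂ) ≠ 0 := Complex.ofReal_ne_zero.mpr (Real.sqrt_pos.mpr ha).ne'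
  have hane : ((a : ℝ) : ℂ) ≠ 0 := Complex.ofReal_ne_zero.mpr ha.ne'
  have e1 : ∀ n : ℤ, Complex.exp (-(π / a * (n + α) ^ 2) : ℝ) =
      Complex.exp (-π / (a : ℂ) * (n + Complex.I * (-Complex.I * α)) ^ 2) := by
    intro n; congr 1; push_cast
    have : Complex.I * (-Complex.I * (α : ℂ)) = α := by
      rw [← mul_assoc, mul_neg, Complex.I_mul_I]; ring
    rw [this]; ring
  have e2 : ∀ n : ℤ, Complex.exp (-π * a * (n : ℂ) ^ 2 - 2 * π * Complex.I * α * n) =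
      Complex.exp (-π * (a : ℂ) * n ^ 2 + 2 * π * (-Complex.I * α) * n) := by
    intro n; congr 1; ring
  simp_rw [e1, e2, h, hsq]
  rw [one_div, ← mul_assoc (Real.sqrt a : ℂ), mul_inv_cancel₀ hne, one_mul]

/-- The dual double series term `exp(-π y t m²) exp(-π y k²/t) e(-x m k)`. [folklore] -/
noncomputable def dTerm (z : ℍ) (t : ℝ) (p : ℤ × ℤ) : ℂ :=
  Complex.exp (-(π * z.im * t * (p.1 : ℝ) ^ 2) : ℝ) * Complex.exp (-(π * z.im / t * (p.2 : ℝ) ^ 2) : ℝ) *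
    Complex.exp (((-(2 * π * z.re * p.1 * p.2) : ℝ) : ℂ) * Complex.I)

/-- `‖dTerm‖` is a product of two Gaussians. [folklore] -/
theorem norm_dTerm (z : ℍ) (t : ℝ) (p : ℤ × ℤ) :
    ‖dTerm z t p‖ = Real.exp (-(π * z.im * t) * (p.1 : ℝ) ^ 2) * Real.exp (-(π * z.im / t) * (p.2 : ℝ) ^ 2) := by
  unfold dTerm
  rw [norm_mul, norm_mul, Complex.norm_exp_ofReal_mul_I, mul_one, Complex.norm_exp, Complex.norm_exp,
    Complex.ofReal_re, Complex.ofReal_re]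
  congr 1 <;> congr 1 <;> ring

/-- Summability of the dual double series, `t > 0`. [folklore] -/
theorem summable_dTerm (z : ℍ) {t : ℝ} (ht : 0 < t) : Summable (dTerm z t) := by
  refine Summable.of_norm ?_
  simp_rw [norm_dTerm]
  have h1 : 0 < π * z.im * t := by have := z.im_pos; positivity
  have h2 : 0 < π * z.im / t := by have := z.im_pos; positivity
  exact (summable_exp_neg_mul_int_sq h1).mul_of_nonneg (summable_exp_neg_mul_int_sq h2)
    (fun _ => (Real.exp_pos _).le) (fun _ => (Real.exp_pos _).le)

/-- The symmetry `(m, k, t) ↔ (k, m, 1/t)` of the dual term. [folklore] -/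
theorem dTerm_swap (z : ℍ) (t : ℝ) (p : ℤ × ℤ) : dTerm z (1 / t) (p.2, p.1) = dTerm z t p := by
  unfold dTerm
  simp only [← Complex.exp_add]
  congr 1
  push_cast
  simp only [mul_inv, inv_inv, div_eq_mul_inv]
  ring

/-- Splitting the theta summand: `-π t Q_z(m, n) = -π y t m² - (π t/y)(n + m x)²`. [folklore] -/
theorem thetaTerm_cons (z : ℍ) {t : ℝ} (ht : 0 < t) (m n : ℤ) :
    Complex.exp (-π * t * qForm z ![m, n] : ℝ) =
      Complex.exp (-(π * z.im * t * (m : ℝ) ^ 2) : ℝ) * Complex.exp (-(π / (z.im / t) * (n + m * z.re) ^ 2) : ℝ) := by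
  rw [← Complex.exp_add, ← Complex.ofReal_add]
  congr 2
  rw [qForm_apply]
  simp only [Matrix.cons_val_zero, Matrix.cons_val_one]
  have hy := z.im_pos.ne'
  field_simp
  ring

/-- **Poisson in the second variable**: `Σ_n e^{-π t Q_z(m, n)} = √(y/t) Σ_k dTerm(m, k)`. [folklore] -/
theorem tsum_thetaTerm_inner (z : ℍ) {t : ℝ} (ht : 0 < t) (m : ℤ) :
    ∑' n : ℤ, Complex.exp (-π * t * qForm z ![m, n] : ℝ) =
      (Real.sqrt (z.im / t) : ℂ) * ∑' k : ℤ, dTerm z t (m, k) := by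
  have ha : 0 < z.im / t := div_pos z.im_pos ht
  simp_rw [thetaTerm_cons z ht]
  rw [tsum_mul_left, tsum_exp_neg_sq_shift ha (m * z.re), ← mul_assoc,
    mul_comm (Complex.exp _) (Real.sqrt _ : ℂ), mul_assoc, ← tsum_mul_left]
  congr 1
  refine tsum_congr fun k => ?_
  unfold dTerm
  simp only [← Complex.exp_add]
  congr 1
  push_cast
  ring

/-- The complex theta summand family is summable. [folklore] -/
theorem summable_thetaTerm_complex (z : ℍ) {t : ℝ} (ht : 0 < t) :
    Summable fun v : Fin 2 → ℤ => Complex.exp (-π * t * qForm z v : ℝ) := by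
  simpa [Complex.ofReal_exp] using Complex.ofRealCLM.summable (summable_exp_qForm z ht)

/-- **`Θ_z(t) = √(y/t) · D_z(t)`** with the dual double series `D_z(t) = Σ_{(m,k)} dTerm(m, k)`. [folklore] -/
theorem thetaQ_eq_sqrt_mul_tsum (z : ℍ) {t : ℝ} (ht : 0 < t) :
    (thetaQ z t : ℂ) = (Real.sqrt (z.im / t) : ℂ) * ∑' p : ℤ × ℤ, dTerm z t p := by
  rw [thetaQ_coe, ← (finTwoArrowEquiv ℤ).symm.tsum_eq]
  simp only [finTwoArrowEquiv_symm_apply]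
  have hs : Summable fun p : ℤ × ℤ => Complex.exp (-π * t * qForm z ![p.1, p.2] : ℝ) := by
    have := (summable_thetaTerm_complex z ht).comp_injective (finTwoArrowEquiv ℤ).symm.injective
    simpa [Function.comp_def] using this
  rw [hs.tsum_prod, (summable_dTerm z ht).tsum_prod]
  simp_rw [tsum_thetaTerm_inner z ht]
  rw [tsum_mul_left]

/-- `√(y t) = t √(y/t)` for `t > 0`. [folklore] -/
theorem sqrt_mul_eq (y : ℝ) {t : ℝ} (ht : 0 < t) : Real.sqrt (y / (1 / t)) = t * Real.sqrt (y / t) := by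
  rw [show y / (1 / t) = t ^ 2 * (y / t) by field_simp, Real.sqrt_mul (sq_nonneg _), Real.sqrt_sq ht.le]

/-- **The theta functional equation `Θ_z(1/t) = t Θ_z(t)`** — the lattice `y^{-1/2}(ℤz + ℤ)` is
unimodular and isometric to its dual; here by Poisson summation in one variable applied twice
(through the symmetric dual series `D_z`). [folklore] -/
theorem thetaQ_functional_equation (z : ℍ) {t : ℝ} (ht : 0 < t) : thetaQ z (1 / t) = t * thetaQ z t := by
  have ht' : 0 < 1 / t := by positivity
  apply Complex.ofReal_injective
  rw [Complex.ofReal_mul, thetaQ_eq_sqrt_mul_tsum z ht', thetaQ_eq_sqrt_mul_tsum z ht,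
    ← (Equiv.prodComm ℤ ℤ).tsum_eq (dTerm z (1 / t))]
  simp only [Equiv.prodComm_apply, Prod.swap, dTerm_swap]
  rw [← mul_assoc, sqrt_mul_eq z.im ht, Complex.ofReal_mul]

/-! ### Continuity of `(z, t) ↦ Θ_z(t)` -/

/-- `(z, t) ↦ e^{-π t Q_z(v)}` is continuous. [folklore] -/
theorem continuous_thetaTerm (v : Fin 2 → ℤ) : Continuous fun p : ℍ × ℝ => Real.exp (-π * p.2 * qForm p.1 v) := by
  unfold qForm
  have h1 : Continuous fun p : ℍ × ℝ => ‖(v 0 : ℂ) * (p.1 : ℂ) + v 1‖ ^ 2 :=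
    ((continuous_const.mul (UpperHalfPlane.continuous_coe.comp continuous_fst)).add continuous_const).norm.pow 2
  have h2 : Continuous fun p : ℍ × ℝ => (p.1).im := UpperHalfPlane.continuous_im.comp continuous_fst
  exact Real.continuous_exp.comp ((continuous_const.mul continuous_snd).mul (h1.div h2 fun p => p.1.im_pos.ne'))

/-- Uniform lower bound for `Q_w` on a vertical box: `Q_w(v) ≥ r(A,B)² ‖v‖²/Y`. [folklore] -/
theorem qForm_ge_of_mem_strip {A B Y : ℝ} (hB : 0 < B) {w : ℍ} (hw : w ∈ verticalStrip A B) (hY : w.im ≤ Y)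
    (v : Fin 2 → ℤ) : r ⟨⟨A, B⟩, hB⟩ ^ 2 * ‖v‖ ^ 2 / Y ≤ qForm w v := by
  have hY0 : 0 < Y := w.im_pos.trans_le hY
  refine le_trans ?_ (qForm_ge w v)
  have hr := r_lower_bound_on_verticalStrip w hB hw
  have hr0 := (r_pos ⟨⟨A, B⟩, hB⟩).le
  have : r ⟨⟨A, B⟩, hB⟩ ^ 2 * ‖v‖ ^ 2 ≤ r w ^ 2 * ‖v‖ ^ 2 := by gcongr
  calc r ⟨⟨A, B⟩, hB⟩ ^ 2 * ‖v‖ ^ 2 / Y ≤ r ⟨⟨A, B⟩, hB⟩ ^ 2 * ‖v‖ ^ 2 / w.im :=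
        div_le_div_of_nonneg_left (by positivity) w.im_pos hY
    _ ≤ r w ^ 2 * ‖v‖ ^ 2 / w.im := by gcongr

/-- **Joint continuity of `(z, t) ↦ Θ_z(t)`** on `ℍ × (0, ∞)` (locally uniform convergence). [folklore] -/
theorem continuousAt_thetaQ (z₀ : ℍ) {t₀ : ℝ} (ht₀ : 0 < t₀) :
    ContinuousAt (fun p : ℍ × ℝ => thetaQ p.1 p.2) (z₀, t₀) := by
  set A : ℝ := |z₀.re| + 1
  set B : ℝ := z₀.im / 2 with hBdef
  have hB : 0 < B := by rw [hBdef]; linarith [z₀.im_pos]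
  set Y : ℝ := 2 * z₀.im with hYdef
  set a : ℝ := t₀ / 2 with hadef
  have ha : 0 < a := by rw [hadef]; linarith
  set V : Set (ℍ × ℝ) := {p | |p.1.re| < A ∧ B < p.1.im ∧ p.1.im < Y ∧ a < p.2} with hV
  have hVo : IsOpen V := by
    have h1 : Continuous fun p : ℍ × ℝ => |p.1.re| :=
      ((Complex.continuous_re.comp UpperHalfPlane.continuous_coe).comp continuous_fst).abs
    have h2 : Continuous fun p : ℍ × ℝ => p.1.im := UpperHalfPlane.continuous_im.comp continuous_fst
    exact (isOpen_lt h1 continuous_const).inter ((isOpen_lt continuous_const h2).inter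
      ((isOpen_lt h2 continuous_const).inter (isOpen_lt continuous_const continuous_snd)))
  have hz₀ : (z₀, t₀) ∈ V :=
    ⟨by simp [A], by rw [hBdef]; linarith [z₀.im_pos], by rw [hYdef]; linarith [z₀.im_pos], by rw [hadef]; linarith⟩
  set c : ℝ := π * a * r ⟨⟨A, B⟩, hB⟩ ^ 2 / Y with hc
  have hc0 : 0 < c := by
    have := r_pos ⟨⟨A, B⟩, hB⟩
    have : 0 < Y := by rw [hYdef]; linarith [z₀.im_pos]
    positivity
  have hcont : ContinuousOn (fun p : ℍ × ℝ => thetaQ p.1 p.2) V := by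
    refine continuousOn_tsum (u := fun v : Fin 2 → ℤ => Real.exp (-c * ‖v‖ ^ 2))
      (fun v => (continuous_thetaTerm v).continuousOn) (summable_exp_neg_mul_norm_sq hc0) ?_
    intro v p hp
    rw [Real.norm_eq_abs, abs_of_pos (Real.exp_pos _)]
    refine Real.exp_le_exp.mpr ?_
    have hq := qForm_ge_of_mem_strip hB (w := p.1) ⟨hp.1.le, hp.2.1.le⟩ hp.2.2.1.le v
    have hq0 := qForm_nonneg p.1 v
    have ht : a ≤ p.2 := hp.2.2.2.le
    have : c * ‖v‖ ^ 2 = π * a * (r ⟨⟨A, B⟩, hB⟩ ^ 2 * ‖v‖ ^ 2 / Y) := by rw [hc]; ring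
    have key : c * ‖v‖ ^ 2 ≤ π * p.2 * qForm p.1 v := by
      rw [this]
      calc π * a * (r ⟨⟨A, B⟩, hB⟩ ^ 2 * ‖v‖ ^ 2 / Y) ≤ π * a * qForm p.1 v := by gcongr
        _ ≤ π * p.2 * qForm p.1 v := by gcongr
    linarith [key]
  exact hcont.continuousAt (hVo.mem_nhds hz₀)

/-- Continuity of `t ↦ Θ_z(t)` on `(0, ∞)`. [folklore] -/
theorem continuousOn_thetaQ (z : ℍ) : ContinuousOn (thetaQ z) (Ioi 0) := fun t ht =>
  ((continuousAt_thetaQ z ht).comp (f := fun t : ℝ => (z, t)) (by fun_prop)).continuousWithinAt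

/-- Continuity of `z ↦ Θ_z(t)` for `t > 0`. [folklore] -/
theorem continuous_thetaQ_left {t : ℝ} (ht : 0 < t) : Continuous fun z : ℍ => thetaQ z t :=
  continuous_iff_continuousAt.mpr fun z =>
    (continuousAt_thetaQ z ht).comp (f := fun z : ℍ => (z, t)) (by fun_prop)

/-! ### The Mellin functional-equation pair and the completed Eisenstein series -/

/-- **The theta FE-pair of `z`**: `f = g = Θ_z`, weight `k = 1`, root number `ε = 1`, constant terms
`f₀ = g₀ = 1` — Riemann's set-up for the Epstein zeta function of `Q_z`. [folklore] -/
noncomputable def thetaFEPair (z : ℍ) : WeakFEPair ℂ where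
  f := fun t => (thetaQ z t : ℂ)
  g := fun t => (thetaQ z t : ℂ)
  k := 1
  ε := 1
  f₀ := 1
  g₀ := 1
  hf_int := (Complex.continuous_ofReal.comp_continuousOn (continuousOn_thetaQ z)).locallyIntegrableOn
    measurableSet_Ioi
  hg_int := (Complex.continuous_ofReal.comp_continuousOn (continuousOn_thetaQ z)).locallyIntegrableOn
    measurableSet_Ioi
  hk := one_pos
  hε := one_ne_zero
  h_feq := fun x hx => by
    simp only [Real.rpow_one, one_mul, smul_eq_mul]
    rw [thetaQ_functional_equation z hx, Complex.ofReal_mul]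
  hf_top := fun r => isBigO_thetaQ_sub_one z r
  hg_top := fun r => isBigO_thetaQ_sub_one z r

/-- The theta FE-pair is self-dual. [folklore] -/
theorem thetaFEPair_symm (z : ℍ) : (thetaFEPair z).symm = thetaFEPair z := by
  unfold thetaFEPair WeakFEPair.symm
  congr 1
  exact inv_one

/-- **The completed Eisenstein series `E*(z, s) = Λ_z(s)/2`**, defined for all `s ∈ ℂ` as the
Mellin transform (Riemann's continuation) attached to `Θ_z`; for `Re s > 1` it equals
`θ(s) E(z, s)`, `θ(s) = π^{-s} Γ(s) ζ(2s)` ((3.27)) — `completedEisenstein_eq_theta_mul`. [cite: Iwaniec2002, (3.27) & (3.31), PDF p. 47] -/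
noncomputable def completedEisenstein (z : ℍ) (s : ℂ) : ℂ := (thetaFEPair z).Λ s / 2

/-- The entire part `Λ₀_z(s)/2` of `E*(z, s)`. [folklore] -/
noncomputable def completedEisenstein₀ (z : ℍ) (s : ℂ) : ℂ := (thetaFEPair z).Λ₀ s / 2

/-- **Pole structure**: `E*(z, s) = E*₀(z, s) - 1/(2s) - 1/(2(1 - s))` with `E*₀(z, ·)` entire — simple
poles at `s = 1` (residue `1/2`, i.e. `res_{s=1} E(z, s) = 1/(2θ(1)) = 3/π`, (3.26)) and `s = 0` only.
[cite: Iwaniec2002, (3.26), PDF p. 47] -/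
theorem completedEisenstein_eq (z : ℍ) (s : ℂ) :
    completedEisenstein z s = completedEisenstein₀ z s - 1 / (2 * s) - 1 / (2 * (1 - s)) := by
  unfold completedEisenstein completedEisenstein₀
  rw [WeakFEPair.Λ]
  simp only [thetaFEPair, smul_eq_mul, mul_one, Complex.ofReal_one]
  rw [one_div (2 * s), one_div (2 * (1 - s)), mul_inv, mul_inv]
  ring

/-- `E*₀(z, ·)` is entire. [folklore] -/
theorem differentiable_completedEisenstein₀ (z : ℍ) : Differentiable ℂ (completedEisenstein₀ z) :=
  (thetaFEPair z).differentiable_Λ₀.div_const 2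

/-- `E*(z, ·)` is holomorphic away from `s = 0, 1`. [folklore] -/
theorem differentiableAt_completedEisenstein (z : ℍ) {s : ℂ} (h0 : s ≠ 0) (h1 : s ≠ 1) :
    DifferentiableAt ℂ (completedEisenstein z) s := by
  unfold completedEisenstein
  refine ((thetaFEPair z).differentiableAt_Λ (Or.inl h0) (Or.inl ?_)).div_const 2
  simpa [thetaFEPair] using h1

/-- **The functional equation `E*(z, 1 - s) = E*(z, s)`**, i.e. `θ(s)E(z, s) = θ(1-s)E(z, 1-s)`
((3.31)); Iwaniec derives it from the Fourier expansion (3.29), here it is Riemann's theta-function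
argument. [cite: Iwaniec2002, (3.31), PDF p. 47] -/
theorem completedEisenstein_one_sub (z : ℍ) (s : ℂ) :
    completedEisenstein z (1 - s) = completedEisenstein z s := by
  unfold completedEisenstein
  have h := (thetaFEPair z).functional_equation s
  rw [thetaFEPair_symm] at h
  simp only [thetaFEPair, one_smul, Complex.ofReal_one] at h ⊢
  rw [h]


/-! ### Identification with `θ(s) E(z, s)` for `Re s > 1` -/

/-- `1/Q_z(v)^σ = y^σ ‖cz + d‖^{-2σ}` (`σ > 0`; both sides vanish at `v = 0`). [folklore] -/
theorem one_div_qForm_rpow (z : ℍ) {σ : ℝ} (hσ : 0 < σ) (v : Fin 2 → ℤ) :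
    1 / qForm z v ^ σ = z.im ^ σ * ‖(v 0 : ℂ) * z + v 1‖ ^ (-(2 * σ)) := by
  by_cases hv : v = 0
  · subst hv
    simp [Real.zero_rpow hσ.ne', Real.zero_rpow (by linarith : -(2 * σ) ≠ 0)]
  unfold qForm
  have hL : 0 < ‖(v 0 : ℂ) * z + v 1‖ := norm_pos_iff.mpr (linear_ne_zero_of_ne_zero hv z)
  rw [Real.div_rpow (by positivity) z.im_pos.le, Real.rpow_neg hL.le, Real.rpow_mul hL.le]
  rw [show ‖(v 0 : ℂ) * z + v 1‖ ^ (2 : ℝ) = ‖(v 0 : ℂ) * z + v 1‖ ^ 2 by norm_cast]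
  have h1 : 0 < (‖(v 0 : ℂ) * z + v 1‖ ^ 2) ^ σ := by positivity
  have h2 : 0 < z.im ^ σ := by have := z.im_pos; positivity
  field_simp

/-- **Summability of `Σ_v Q_z(v)^{-σ}`, `σ > 1`** (the Epstein zeta function converges absolutely). [folklore] -/
theorem summable_one_div_qForm_rpow (z : ℍ) {σ : ℝ} (hσ : 1 < σ) :
    Summable fun v : Fin 2 → ℤ => 1 / qForm z v ^ σ := by
  have hσ0 : 0 < σ := by linarith
  simp_rw [one_div_qForm_rpow z hσ0]
  refine Summable.of_nonneg_of_le (fun v => by have := z.im_pos; positivity)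
    (fun v => mul_le_mul_of_nonneg_left (summand_bound z (by linarith) v) (by have := z.im_pos; positivity))
    (((summable_one_div_norm_rpow (k := 2 * σ) (by linarith)).mul_left (z.im ^ σ * r z ^ (-(2 * σ)))).congr
      fun v => by ring)

/-- `esTerm s v z = 1/Q_z(v)^s` (complex powers of the non-negative real `Q_z(v)`). [folklore] -/
theorem esTerm_eq_one_div_qForm_cpow (s : ℂ) (v : Fin 2 → ℤ) (z : ℍ) :
    esTerm s v z = 1 / ((qForm z v : ℝ) : ℂ) ^ s := by
  unfold esTerm qForm
  rw [one_div, ← Complex.inv_cpow _ _ (by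
    rw [Complex.arg_ofReal_of_nonneg (by positivity)]; exact Real.pi_pos.ne)]
  congr 1
  push_cast
  rw [inv_div]

/-- `‖esTerm s v z‖ = 1/Q_z(v)^{Re s}` for `Re s > 0`. [folklore] -/
theorem norm_esTerm_eq (z : ℍ) {s : ℂ} (hs : 0 < s.re) (v : Fin 2 → ℤ) :
    ‖esTerm s v z‖ = 1 / qForm z v ^ s.re := by
  rw [esTerm_eq_one_div_qForm_cpow, norm_div, norm_one,
    Complex.norm_cpow_eq_rpow_re_of_nonneg (qForm_nonneg z v) (fun h => ?_)]
  rw [h] at hs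
  exact lt_irrefl _ hs

/-- Summability of `v ↦ esTerm s v z` over all of `ℤ²`, `Re s > 1`. [folklore] -/
theorem summable_esTerm_all {s : ℂ} (hs : 1 < s.re) (z : ℍ) : Summable fun v : Fin 2 → ℤ => esTerm s v z := by
  refine Summable.of_norm ?_
  simp_rw [norm_esTerm_eq z (by linarith : 0 < s.re)]
  exact summable_one_div_qForm_rpow z hs

/-- Scaling: `esTerm s (n·w) z = n^{-2s} esTerm s w z` for a multiple `v = n w` with `gcd(v) = n ≥ 1`. [folklore] -/
theorem esTerm_of_gammaSet_eq_divIntMap (s : ℂ) (z : ℍ) {n : ℕ} [NeZero n] (v : gammaSet 1 n 0) :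
    esTerm s v z = ((n : ℂ) ^ (2 * s))⁻¹ * esTerm s (divIntMap n v) z := by
  have hv := gammaSet_eq_gcd_mul_divIntMap v.2
  set w : Fin 2 → ℤ := divIntMap n v with hw
  have hn : (0 : ℝ) < n := Nat.cast_pos.mpr (Nat.pos_of_ne_zero (NeZero.ne n))
  unfold esTerm
  rw [hv]
  simp only [Pi.smul_apply, nsmul_eq_mul, Int.cast_mul, Int.cast_natCast]
  have e : z.im / ‖((n : ℂ)) * (w 0 : ℂ) * z + (n : ℂ) * (w 1 : ℂ)‖ ^ 2 =
      (n : ℝ)⁻¹ * ((n : ℝ)⁻¹ * (z.im / ‖(w 0 : ℂ) * z + w 1‖ ^ 2)) := by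
    rw [show ((n : ℂ)) * (w 0 : ℂ) * z + (n : ℂ) * (w 1 : ℂ) = (n : ℂ) * ((w 0 : ℂ) * z + w 1) by ring,
      norm_mul, Complex.norm_natCast]
    field_simp
  have hb : 0 ≤ z.im / ‖(w 0 : ℂ) * z + w 1‖ ^ 2 := by have := z.im_pos; positivity
  rw [e, Complex.ofReal_mul, Complex.mul_cpow_ofReal_nonneg (by positivity) (by positivity),
    Complex.ofReal_mul, Complex.mul_cpow_ofReal_nonneg (by positivity) hb,
    Complex.ofReal_inv, Complex.ofReal_natCast,
    Complex.inv_cpow _ _ (by rw [← Complex.ofReal_natCast, Complex.arg_ofReal_of_nonneg (Nat.cast_nonneg _)]; exact Real.pi_pos.ne),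
    show (2 : ℂ) * s = ((2 : ℕ) : ℂ) * s by norm_num, Complex.cpow_nat_mul]
  ring

/-- **`Σ_{(c,d) ∈ ℤ²} (y/|cz+d|²)^s = ζ(2s) · Σ_{(c,d)=1} (y/|cz+d|²)^s = 2ζ(2s) E(z, s)`**, `Re s > 1`
(sorting by the gcd; `EisensteinSeries.gammaSetDivGcdSigmaEquiv`). [folklore] -/
theorem tsum_esTerm_eq_zeta_mul {s : ℂ} (hs : 1 < s.re) (z : ℍ) :
    ∑' v : Fin 2 → ℤ, esTerm s v z = riemannZeta (2 * s) * ∑' w : gammaSet 1 1 0, esTerm s w z := by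
  have h2s : 1 < (2 * s).re := by simp; linarith
  have hs0 : s ≠ 0 := fun h => by rw [h, Complex.zero_re] at hs; linarith
  have hsum := summable_esTerm_all hs z
  rw [← gammaSetDivGcdSigmaEquiv.symm.tsum_eq]
  simp_rw [gammaSetDivGcdSigmaEquiv_symm_eq]
  rw [Summable.tsum_sigma ?hsumm, zeta_eq_tsum_one_div_nat_cpow h2s,
    tsum_mul_tsum_of_summable_norm ?hf ?hg]
  case hsumm =>
    exact gammaSetDivGcdSigmaEquiv.symm.summable_iff.mpr hsum |>.congr <| by simp
  case hf =>
    simpa using (Complex.summable_one_div_nat_cpow.mpr h2s).norm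
  case hg =>
    exact hsum.norm.subtype _
  simp_rw [one_div]
  rw [Summable.tsum_prod' ?h₁ fun b => ?h₂]
  case h₁ =>
    exact summable_mul_of_summable_norm (f := fun n : ℕ => ((n : ℂ) ^ (2 * s))⁻¹)
      (g := fun w : gammaSet 1 1 0 => esTerm s w z) (by simpa using (Complex.summable_one_div_nat_cpow.mpr h2s).norm)
      (hsum.norm.subtype _)
  case h₂ =>
    simpa using (hsum.norm.subtype _).of_norm.mul_left (a := ((b : ℂ) ^ (2 * s))⁻¹)
  refine tsum_congr fun b => ?_
  rcases eq_or_ne b 0 with rfl | hb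
  · -- gcd 0: only v = 0, where esTerm s 0 z = 0^s = 0
    have h0 : ∀ v : gammaSet 1 0 0, esTerm s v z = 0 := by
      intro v
      have hv : (v : Fin 2 → ℤ) = 0 := by
        have := (gammaSet_one_mem_iff (r := 0) v.1).mp v.2
        rw [Int.gcd_eq_zero_iff] at this
        ext i; fin_cases i <;> simp [this.1, this.2]
      rw [hv]
      simp [esTerm, Complex.zero_cpow hs0]
    simp [tsum_congr h0, Complex.zero_cpow (mul_ne_zero two_ne_zero hs0)]
  · haveI : NeZero b := ⟨hb⟩
    simpa [esTerm_of_gammaSet_eq_divIntMap s z, tsum_mul_left, hb]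
      using (gammaSetDivGcdEquiv b).tsum_eq (fun w => ((b : ℂ) ^ (2 * s))⁻¹ * esTerm s w z)

/-- **`E*(z, s) = θ(s) E(z, s)` for `Re s > 1`**, `θ(s) = π^{-s} Γ(s) ζ(2s)` ((3.27)): the Mellin
transform of `Θ_z - 1` computed termwise (`hasSum_mellin_pi_mul₀`) and sorted by the gcd. [cite: Iwaniec2002, (3.27), PDF p. 47] -/
theorem completedEisenstein_eq_theta_mul (z : ℍ) {s : ℂ} (hs : 1 < s.re) :
    completedEisenstein z s = (π : ℂ) ^ (-s) * Complex.Gamma s * riemannZeta (2 * s) * eisensteinE z s := by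
  have hs0 : 0 < s.re := by linarith
  have hM := (thetaFEPair z).hasMellin (s := s) (by simpa [thetaFEPair] using hs)
  have hF : ∀ t ∈ Ioi (0 : ℝ), HasSum (fun v : Fin 2 → ℤ =>
      if qForm z v = 0 then (0 : ℂ) else 1 * (Real.exp (-π * qForm z v * t) : ℝ)) ((thetaQ z t : ℂ) - 1) :=
    fun t ht => hasSum_thetaQ_sub_one z ht
  have hS := hasSum_mellin_pi_mul₀ (a := fun _ : Fin 2 → ℤ => (1 : ℂ)) (fun v => qForm_nonneg z v) hs0 hF
    (by simpa using summable_one_div_qForm_rpow z hs)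
  have e1 : mellin (fun t => (thetaQ z t : ℂ) - 1) s = (thetaFEPair z).Λ s := by
    have := hM.2
    simpa [thetaFEPair] using this
  have e2 : ∑' v : Fin 2 → ℤ, (π : ℂ) ^ (-s) * Complex.Gamma s * 1 / ((qForm z v : ℝ) : ℂ) ^ s =
      (π : ℂ) ^ (-s) * Complex.Gamma s * ∑' v : Fin 2 → ℤ, esTerm s v z := by
    rw [← tsum_mul_left]
    refine tsum_congr fun v => ?_
    rw [esTerm_eq_one_div_qForm_cpow]
    ring
  unfold completedEisenstein
  rw [← e1, ← hS.tsum_eq, e2, tsum_esTerm_eq_zeta_mul hs z]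
  unfold eisensteinE
  ring

/-! ### Automorphy of `Θ_z` and `E*(z, s)` under `SL₂(ℤ)` -/

/-- `c(Az) + d = (c'z + d')/j(A, z)` with `(c', d') = (c, d)A`, for every integer row. [folklore] -/
theorem linear_smul_eq_all (v : Fin 2 → ℤ) (A : SL(2, ℤ)) (z : ℍ) :
    (v 0 : ℂ) * (A • z : ℍ) + v 1 = (((Matrix.vecMul v A.1) 0 : ℂ) * z + (Matrix.vecMul v A.1) 1) / denom A z := by
  have h := eisSummand_SL2_apply (-1) v A z
  simp only [eisSummand, neg_neg, zpow_one] at h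
  rw [h, zpow_neg_one, div_eq_inv_mul]

/-- **`Q_{Az}(v) = Q_z(vA)`**: the lattice `ℤ(Az) + ℤ` is `(ℤz + ℤ)/j(A, z)`. [folklore] -/
theorem qForm_smul (A : SL(2, ℤ)) (z : ℍ) (v : Fin 2 → ℤ) : qForm (A • z) v = qForm z (Matrix.vecMul v A.1) := by
  unfold qForm
  have hD : denom A z ≠ 0 := denom_ne_zero A z
  have hDn : 0 < ‖denom A z‖ := norm_pos_iff.mpr hD
  rw [linear_smul_eq_all v A z, ModularGroup.im_smul_eq_div_normSq A z, norm_div, div_pow,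
    Complex.normSq_eq_norm_sq]
  have hy := z.im_pos.ne'
  field_simp

/-- Right multiplication by `A ∈ SL₂(ℤ)` permutes `ℤ²`. [folklore] -/
def ModularEisensteinContinuation.vecMulEquiv (A : SL(2, ℤ)) : (Fin 2 → ℤ) ≃ (Fin 2 → ℤ) where
  toFun v := Matrix.vecMul v A.1
  invFun v := Matrix.vecMul v (A⁻¹).1
  left_inv v := by
    simp only [Matrix.vecMul_vecMul, ← Matrix.SpecialLinearGroup.coe_mul, mul_inv_cancel,
      Matrix.SpecialLinearGroup.coe_one, Matrix.vecMul_one]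
  right_inv v := by
    simp only [Matrix.vecMul_vecMul, ← Matrix.SpecialLinearGroup.coe_mul, inv_mul_cancel,
      Matrix.SpecialLinearGroup.coe_one, Matrix.vecMul_one]

/-- **`Θ_{Az}(t) = Θ_z(t)`** for `A ∈ SL₂(ℤ)`. [folklore] -/
theorem thetaQ_smul (A : SL(2, ℤ)) (z : ℍ) (t : ℝ) : thetaQ (A • z) t = thetaQ z t := by
  unfold thetaQ
  simp_rw [qForm_smul A z]
  exact (ModularEisensteinContinuation.vecMulEquiv A).tsum_eq (fun v => Real.exp (-π * t * qForm z v))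

/-- The theta FE-pair is `SL₂(ℤ)`-invariant. [folklore] -/
theorem thetaFEPair_smul (A : SL(2, ℤ)) (z : ℍ) : thetaFEPair (A • z) = thetaFEPair z := by
  unfold thetaFEPair
  congr 1 <;> funext t <;> rw [thetaQ_smul]

/-- **Automorphy of the completed Eisenstein series for all `s`**: `E*(Az, s) = E*(z, s)`,
`A ∈ SL₂(ℤ)` — the continuation of the automorphy of `E(z, s)` from `Re s > 1`. [cite: Iwaniec2002, §3.1 (3.1) & (3.31), PDF pp. 40, 47] -/
theorem completedEisenstein_smul (A : SL(2, ℤ)) (z : ℍ) (s : ℂ) :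
    completedEisenstein (A • z) s = completedEisenstein z s := by
  unfold completedEisenstein
  rw [thetaFEPair_smul]

/-- Likewise for the entire part. [folklore] -/
theorem completedEisenstein₀_smul (A : SL(2, ℤ)) (z : ℍ) (s : ℂ) :
    completedEisenstein₀ (A • z) s = completedEisenstein₀ z s := by
  unfold completedEisenstein₀
  rw [thetaFEPair_smul]

end Theta

end Literature.NumberTheory.Automorphic
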